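import Literature.NumberTheory.Sieve.LargeSieveInequality

/-!
# The large sieve for characters, Vaughan's Lemmas 1 and 2, and Pólya–Vinogradov

This file is the second layer (after `LargeSieveInequality.lean`) of the discharge of Vaughan's
mean value theorem `Literature.NumberTheory.Sieve.vaughan_meanValue` (Vaughan, Acta Arith. 37 (1980), Theorem 1),
the large-sieve input of the Bombieri–Vinogradov theorem (`Literature.NumberTheory.Sieve.bombieri_vinogradov`,
parity.S27, see `BombieriVinogradovReduction.lean`). Everything here is proved, with explicit
constants:

* **Gauss sums of primitive characters** (`norm_gaussSum_sq`: `|τ(χ)|² = q`, Cojocaru–Murty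
  (8.15); `sum_inv_mul_e_eq`: `∑_{b mod q} χ⁻¹(b) e(bn/q) = τ(χ⁻¹) χ(n)` for *all* `n`,
  Cojocaru–Murty (8.16)), from Mathlib's discrete Fourier transform on `ZMod q`
  (`ZMod.dft_dft`, `DirichletCharacter.IsPrimitive.fourierTransform_eq_inv_mul_gaussSum`).
* **The large sieve for primitive characters** (`largeSieve_character`, Cojocaru–Murty
  Thm 8.3.1 "first modified large sieve inequality"): for `a_n` supported on `(M₀, M₀ + N]`,
  `∑_{q ≤ Q} (q/φ(q)) ∑*_{χ mod q} |∑_n a_n χ(n)|² ≤ (N + 1 + 2Q²) ∑_n |a_n|²`,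
  via Parseval on `(ℤ/qℤ)ˣ` (`sum_norm_sq_sum_char_mul`) and `largeSieve_farey`.
* **Vaughan's Lemma 1** (`largeSieve_bilinear`): by Cauchy–Schwarz,
  `∑_{q ≤ Q} (q/φ(q)) ∑*_χ |∑_m ∑_n a_m b_n χ(mn)|`
  `  ≤ ((M+1+2Q²) ∑|a_m|²)^{1/2} ((N+1+2Q²) ∑|b_n|²)^{1/2}`.
* **Geometric sums** (`norm_sum_Ioc_e_le`: `|∑_{A < n ≤ A+N} e(nt)| ≤ 2/|e(t) − 1|`;
  `inv_norm_e_sub_one_le`: `1/|e(b/q) − 1| ≤ q/(4b) + q/(4(q − b))` for `0 < b < q`, Jordan's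
  inequality on both halves of the period; `sum_Ioo_div_add_div_le`: their sum over `0 < b < q`
  is `≤ (q/2)(1 + log q)`).
* **The Pólya–Vinogradov inequality** for primitive `χ mod q ≥ 2` (`polyaVinogradov`,
  Cojocaru–Murty (8.14)): `|∑_{A < n ≤ A+N} χ(n)| ≤ √q (1 + log q)`.
* **Vaughan's Lemma 2** (`largeSieve_bilinear_hyperbolic`): the same bilinear bound with the
  hyperbolic cut-off `mn ≤ X` inside the absolute value, uniformly over any choice of integers
  `X(q, χ) ≤ Y`, at the cost of a factor `2 + log P`, `P ≤ (4Y + 5)(M₀ + M)(N₀ + N)` (for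
  `M₀ + M, N₀ + N ≥ 1`).

## Separation of variables without Perron's formula

Vaughan proves Lemma 2 with the truncated integral
`δ(β) = ∫_{-A}^{A} e^{iβα} (sin γα)/(Cα) dα + O(A⁻¹|γ − β|⁻¹)`. We use an arithmetic substitute
with the same effect (section `Separation`): on the logarithmic scale `u(m) = ⌊T log m⌋`,
`T = 4(Y + 1)`, the condition `mn ≤ X` (`1 ≤ X ≤ Y`, `m, n ≥ 1`) is *equivalent* to
`u(m) + u(n) ≤ Z(X) := ⌊T log(X + 1/2)⌋` (`mul_le_iff_ulog_add_ulog_le`: the values `log(mn)`,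
`mn` an integer, stay `≥ 1/(2X + 2)` away from `log(X + 1/2)`, while the discretisation errors
are `< 2/T`); and the indicator of an initial segment `w ≤ Z'` of `{0, …, P − 1}` has the finite
Fourier expansion `∑_{k mod P} c_k e(kw/P)` (`ite_le_eq_sum_e_mul_sepCoeff`) with
`|c_k| ≤ γ_k`, `∑_k γ_k ≤ 2 + log P` (`sum_sepWeight_le`, geometric sums and Jordan's inequality
again). Since `e(k(u(m) + u(n))/P) = e(ku(m)/P) e(ku(n)/P)`, each `k` contributes a complete
bilinear form with twisted coefficients of the same moduli (`twist`, `norm_twist`), to which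
Lemma 1 applies; the majorant `γ_k` does not depend on `X`, which may therefore vary with
`(q, χ)`.

## References

* R. C. Vaughan, *An elementary method in prime number theory*, Acta Arith. 37 (1980), 111–115,
  Lemmas 1 and 2. [Vaughan1980]
* A. C. Cojocaru, M. R. Murty, *An Introduction to Sieve Methods and their Applications*
  (CUP, 2005), §8.3: (8.14)–(8.17), Theorem 8.3.1. [CojocaruMurty2005]
* M. N. Huxley, *The Distribution of Prime Numbers* (Clarendon Press, 1972), ch. 18,
  (18.9)–(18.12). [Huxley1972]
* H. Davenport, *Multiplicative Number Theory*, 3rd ed. (Springer, 2000), chs. 9, 23, 27.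
-/

open Finset Real Complex
open scoped ComplexConjugate FourierTransform

namespace Literature.NumberTheory.Sieve.LargeSieve

/-! ### Gauss sums of primitive characters -/

section GaussSum

open DirichletCharacter

variable {q : ℕ} [NeZero q]

/-- Complex conjugation inverts the values of a Dirichlet character. [folklore] -/
theorem conj_apply_eq_inv_apply (χ : DirichletCharacter ℂ q) (a : ZMod q) :
    conj (χ a) = χ⁻¹ a := by
  by_cases ha : IsUnit a
  · obtain ⟨u, rfl⟩ := ha
    rw [MulChar.inv_apply_eq_inv', Complex.inv_eq_conj (χ.unit_norm_eq_one u)]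
  · rw [MulChar.map_nonunit _ ha, MulChar.map_nonunit _ ha, map_zero]

/-- `conj χ(a) = χ(a⁻¹)` for units `a`. [folklore] -/
theorem conj_apply_of_isUnit (χ : DirichletCharacter ℂ q) {a : ZMod q} (ha : IsUnit a) :
    conj (χ a) = χ a⁻¹ := by
  obtain ⟨u, rfl⟩ := ha
  rw [conj_apply_eq_inv_apply, MulChar.inv_apply, Ring.inverse_unit, ZMod.inv_coe_unit]

omit [NeZero q] in
/-- The inverse of a primitive character is primitive. [folklore] -/
theorem isPrimitive_inv {χ : DirichletCharacter ℂ q} (hχ : χ.IsPrimitive) : χ⁻¹.IsPrimitive := by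
  rw [isPrimitive_def] at hχ ⊢
  rw [conductor_inv, hχ]

omit [NeZero q] in
/-- `χ(-1)² = 1`. [folklore] -/
theorem apply_neg_one_mul_self (χ : DirichletCharacter ℂ q) : χ (-1) * χ (-1) = 1 := by
  rw [← map_mul, neg_one_mul, neg_neg, map_one]

omit [NeZero q] in
/-- `χ⁻¹(-1) = χ(-1)`. [folklore] -/
theorem inv_apply_neg_one (χ : DirichletCharacter ℂ q) : χ⁻¹ (-1) = χ (-1) := by
  rw [MulChar.inv_apply_eq_inv']
  exact inv_eq_of_mul_eq_one_left (apply_neg_one_mul_self χ)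

/-- `conj τ(χ) = χ(-1) τ(χ⁻¹)` for the Gauss sum `τ(χ) = ∑_a χ(a) e(a/q)`
(Davenport, *Multiplicative Number Theory*, ch. 9). [folklore] -/
theorem conj_gaussSum (χ : DirichletCharacter ℂ q) :
    conj (gaussSum χ ZMod.stdAddChar) = χ (-1) * gaussSum χ⁻¹ ZMod.stdAddChar := by
  have hψ : ∀ a : ZMod q, conj (ZMod.stdAddChar a) = ZMod.stdAddChar (-a) := fun a => by
    rw [AddChar.map_neg_eq_inv, ZMod.stdAddChar_apply, ← Circle.coe_inv_eq_conj, Circle.coe_inv]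
  simp only [gaussSum, map_sum, map_mul, conj_apply_eq_inv_apply, hψ, mul_sum]
  rw [← Equiv.sum_comp (Equiv.neg (ZMod q))]
  refine Fintype.sum_congr _ _ fun a => ?_
  rw [Equiv.neg_apply, neg_neg, ← neg_one_mul a, map_mul, inv_apply_neg_one, mul_assoc]

/-- `τ(χ) τ(χ⁻¹) = χ(-1) q` for primitive `χ` (Fourier inversion on `ℤ/qℤ`, from Mathlib's
`ZMod.dft_dft` and `DirichletCharacter.IsPrimitive.fourierTransform_eq_inv_mul_gaussSum`).
[folklore] -/
theorem gaussSum_mul_gaussSum_inv {χ : DirichletCharacter ℂ q} (hχ : χ.IsPrimitive) :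
    gaussSum χ ZMod.stdAddChar * gaussSum χ⁻¹ ZMod.stdAddChar = χ (-1) * q := by
  have hχ' := isPrimitive_inv hχ
  have h1 : ZMod.dft (⇑χ) = fun k => gaussSum χ ZMod.stdAddChar * χ⁻¹ (-k) := by
    ext k; rw [hχ.fourierTransform_eq_inv_mul_gaussSum, mul_comm]
  have h2 : ZMod.dft (ZMod.dft (⇑χ)) = fun j => (q : ℂ) • χ (-j) := ZMod.dft_dft _
  have h3 : ZMod.dft (ZMod.dft (⇑χ)) =
      fun j => gaussSum χ ZMod.stdAddChar * (gaussSum χ⁻¹ ZMod.stdAddChar * χ j) := by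
    rw [h1, ZMod.dft_const_mul, ZMod.dft_comp_neg]
    ext j
    dsimp only
    rw [hχ'.fourierTransform_eq_inv_mul_gaussSum, neg_neg, inv_inv, mul_comm (χ j)]
  have h4 := congr_fun (h3.symm.trans h2) 1
  simp only [map_one, mul_one, smul_eq_mul] at h4
  rw [h4, mul_comm]

/-- `|τ(χ)|² = q` for a primitive character `χ mod q` (Cojocaru–Murty (8.15); Davenport ch. 9,
(5)). [cite: CojocaruMurty2005, (8.15)] -/
theorem norm_gaussSum_sq {χ : DirichletCharacter ℂ q} (hχ : χ.IsPrimitive) :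
    ‖gaussSum χ ZMod.stdAddChar‖ ^ 2 = q := by
  have h1 := gaussSum_mul_gaussSum_inv hχ
  have h2 : gaussSum χ⁻¹ ZMod.stdAddChar = χ (-1) * conj (gaussSum χ ZMod.stdAddChar) := by
    rw [conj_gaussSum, ← mul_assoc, apply_neg_one_mul_self, one_mul]
  rw [h2, mul_left_comm, Complex.mul_conj, Complex.normSq_eq_norm_sq] at h1
  have hne : χ (-1) ≠ 0 := fun h => by simpa [h] using apply_neg_one_mul_self χ
  exact_mod_cast mul_left_cancel₀ hne h1

/-- Sums over `0 ≤ b < q` are sums over `ZMod q`. [folklore] -/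
theorem sum_range_eq_sum_zmod {A : Type*} [AddCommMonoid A] (f : ZMod q → A) :
    ∑ b ∈ range q, f b = ∑ j : ZMod q, f j := by
  refine Finset.sum_nbij' (fun b : ℕ => (b : ZMod q)) (fun j => j.val) (by simp)
    (fun j _ => mem_range.2 (ZMod.val_lt j)) (fun b hb => ?_) (fun j _ => ?_) (fun _ _ => rfl)
  · exact ZMod.val_cast_of_lt (mem_range.1 hb)
  · exact ZMod.natCast_zmod_val j

/-- `e(bn/q)` is the standard additive character of `ZMod q` at `bn`. [folklore] -/
theorem e_div_eq_stdAddChar (b : ℕ) (n : ℤ) :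
    e ((b : ℝ) * n / q) = ZMod.stdAddChar ((b : ZMod q) * (n : ZMod q)) := by
  have : ((b : ZMod q) * (n : ZMod q)) = (((b : ℤ) * n : ℤ) : ZMod q) := by push_cast; ring
  rw [this, ZMod.stdAddChar_coe, e_eq_exp]
  congr 1; push_cast; ring

/-- **Primitive characters are finite Fourier transforms of themselves**: for `χ` primitive
mod `q` and every integer `n`, coprime to `q` or not,
`∑_{b mod q} χ⁻¹(b) e(bn/q) = τ(χ⁻¹) χ(n)` (Cojocaru–Murty (8.16), stated there for `(n, q) = 1`;
for primitive `χ` both sides vanish when `(n, q) > 1`, Davenport, *Multiplicative Number Theory*,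
ch. 9; here from Mathlib's `IsPrimitive.fourierTransform_eq_inv_mul_gaussSum`).
[cite: CojocaruMurty2005, (8.16)] -/
theorem sum_inv_mul_e_eq {χ : DirichletCharacter ℂ q} (hχ : χ.IsPrimitive) (n : ℤ) :
    ∑ b ∈ range q, χ⁻¹ b * e ((b : ℝ) * n / q) = gaussSum χ⁻¹ ZMod.stdAddChar * χ n := by
  have h1 : ∑ b ∈ range q, χ⁻¹ b * e ((b : ℝ) * n / q) =
      ∑ j : ZMod q, ZMod.stdAddChar (-(j * -(n : ZMod q))) * χ⁻¹ j := by
    rw [← sum_range_eq_sum_zmod]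
    refine sum_congr rfl fun b _ => ?_
    rw [e_div_eq_stdAddChar, mul_neg, neg_neg, mul_comm]
  have h2 := (isPrimitive_inv hχ).fourierTransform_eq_inv_mul_gaussSum (-(n : ZMod q))
  rw [ZMod.dft_apply, inv_inv, neg_neg] at h2
  simp only [smul_eq_mul] at h2
  rw [h1, h2, mul_comm]

/-- The same with `n` a natural number. [folklore] -/
theorem sum_inv_mul_e_eq_nat {χ : DirichletCharacter ℂ q} (hχ : χ.IsPrimitive) (n : ℕ) :
    ∑ b ∈ range q, χ⁻¹ b * e ((b : ℝ) * n / q) = gaussSum χ⁻¹ ZMod.stdAddChar * χ n := by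
  have h := sum_inv_mul_e_eq hχ (n : ℤ)
  simp only [Int.cast_natCast] at h
  exact h

/-- Character sums as exponential sums: for `χ` primitive mod `q` and any finitely supported
`a_n`, `τ(χ⁻¹) ∑_n a_n χ(n) = ∑_{b mod q} χ⁻¹(b) ∑_n a_n e(bn/q)`. [folklore] -/
theorem gaussSum_mul_sum_mul_char {χ : DirichletCharacter ℂ q} (hχ : χ.IsPrimitive)
    (S : Finset ℤ) (a : ℤ → ℂ) :
    gaussSum χ⁻¹ ZMod.stdAddChar * ∑ n ∈ S, a n * χ n =
      ∑ b ∈ range q, χ⁻¹ b * ∑ n ∈ S, a n * e ((b : ℝ) * n / q) := by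
  calc gaussSum χ⁻¹ ZMod.stdAddChar * ∑ n ∈ S, a n * χ n
      = ∑ n ∈ S, a n * (gaussSum χ⁻¹ ZMod.stdAddChar * χ n) := by
        rw [mul_sum]; exact sum_congr rfl fun n _ => by ring
    _ = ∑ n ∈ S, ∑ b ∈ range q, a n * (χ⁻¹ b * e ((b : ℝ) * n / q)) := by
        refine sum_congr rfl fun n _ => ?_
        rw [← sum_inv_mul_e_eq hχ n, mul_sum]
    _ = _ := by
        rw [sum_comm]
        refine sum_congr rfl fun b _ => ?_
        rw [mul_sum]
        exact sum_congr rfl fun n _ => by ring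

/-- **Orthogonality of characters in mean square** (Parseval on `(ℤ/qℤ)ˣ`): for complex `c_b`,
`∑_{χ mod q} |∑_{0 ≤ b < q} χ(b) c_b|² = φ(q) ∑_{0 ≤ b < q, (b,q)=1} |c_b|²`. [folklore] -/
theorem sum_norm_sq_sum_char_mul (c : ℕ → ℂ) :
    ∑ χ : DirichletCharacter ℂ q, ‖∑ b ∈ range q, χ b * c b‖ ^ 2 =
      q.totient * ∑ b ∈ range q with b.Coprime q, ‖c b‖ ^ 2 := by
  set U := (range q).filter fun b => b.Coprime q with hU
  have hres : ∀ χ : DirichletCharacter ℂ q, ∑ b ∈ range q, χ b * c b = ∑ b ∈ U, χ b * c b := by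
    intro χ
    rw [hU, sum_filter]
    refine sum_congr rfl fun b _ => ?_
    split_ifs with hb
    · rfl
    · rw [MulChar.map_nonunit _ (mt (ZMod.isUnit_iff_coprime b q).1 hb), zero_mul]
  have hC : ∀ z : ℂ, ((‖z‖ : ℝ) : ℂ) ^ 2 = z * conj z := fun z => by
    rw [Complex.mul_conj, Complex.normSq_eq_norm_sq, Complex.ofReal_pow]
  have key : ((∑ χ : DirichletCharacter ℂ q, ‖∑ b ∈ U, χ b * c b‖ ^ 2 : ℝ) : ℂ) =
      ((q.totient * ∑ b ∈ U, ‖c b‖ ^ 2 : ℝ) : ℂ) := by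
    push_cast
    simp only [hC, map_sum, map_mul, sum_mul_sum]
    rw [sum_comm]
    have inner : ∀ b ∈ U, ∑ χ : DirichletCharacter ℂ q, ∑ b' ∈ U,
        χ b * c b * (conj (χ b') * conj (c b')) = q.totient * (c b * conj (c b)) := by
      intro b hb
      rw [sum_comm]
      have hval : ∀ b' ∈ U, ∑ χ : DirichletCharacter ℂ q, χ b * c b * (conj (χ b') * conj (c b')) =
          if b' = b then (q.totient : ℂ) * (c b * conj (c b')) else 0 := by
        intro b' hb'
        have hu : IsUnit ((b' : ℕ) : ZMod q) :=
          (ZMod.isUnit_iff_coprime b' q).2 (mem_filter.1 hb').2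
        have e1 : ∀ χ : DirichletCharacter ℂ q, χ b * c b * (conj (χ b') * conj (c b')) =
            χ ((b' : ℕ) : ZMod q)⁻¹ * χ b * (c b * conj (c b')) := fun χ => by
          rw [conj_apply_of_isUnit χ hu]; ring
        rw [Fintype.sum_congr _ _ e1, ← sum_mul, DirichletCharacter.sum_char_inv_mul_char_eq ℂ hu]
        have hiff : ((b' : ℕ) : ZMod q) = ((b : ℕ) : ZMod q) ↔ b' = b := by
          constructor
          · intro h
            have h1 := congr_arg ZMod.val h
            rwa [ZMod.val_cast_of_lt (mem_range.1 (mem_filter.1 hb').1),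
              ZMod.val_cast_of_lt (mem_range.1 (mem_filter.1 hb).1)] at h1
          · rintro rfl; rfl
        by_cases hbb : b' = b
        · rw [if_pos (hiff.2 hbb), if_pos hbb]
        · rw [if_neg (mt hiff.1 hbb), if_neg hbb, zero_mul]
      rw [sum_congr rfl hval, sum_ite_eq' U b, if_pos hb]
    rw [sum_congr rfl inner, mul_sum]
  rw [Fintype.sum_congr _ _ fun χ => by rw [hres χ]]
  exact_mod_cast key

open scoped Classical in
/-- **From primitive characters to exponential sums** (the last display in the proof of
Cojocaru–Murty Thm 8.3.1; Huxley 1972, ch. 18, (18.9)–(18.11)): for `q ≥ 1` and any finitely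
supported `a_n`, `(q/φ(q)) ∑*_{χ mod q} |∑_n a_n χ(n)|² ≤ ∑*_{b mod q} |∑_n a_n e(bn/q)|²`.
[cite: CojocaruMurty2005, Thm 8.3.1 (proof)] -/
theorem mul_sum_primitive_norm_sq_le (S : Finset ℤ) (a : ℤ → ℂ) :
    (q : ℝ) / q.totient *
        ∑ χ : DirichletCharacter ℂ q with χ.IsPrimitive, ‖∑ n ∈ S, a n * χ n‖ ^ 2 ≤
      ∑ b ∈ range q with b.Coprime q, ‖∑ n ∈ S, a n * e ((b : ℝ) * n / q)‖ ^ 2 := by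
  set Sb : ℕ → ℂ := fun b => ∑ n ∈ S, a n * e ((b : ℝ) * n / q) with hSb
  have h1 : ∀ χ : DirichletCharacter ℂ q, χ.IsPrimitive →
      (q : ℝ) * ‖∑ n ∈ S, a n * χ n‖ ^ 2 = ‖∑ b ∈ range q, χ⁻¹ b * Sb b‖ ^ 2 := by
    intro χ hχ
    rw [← gaussSum_mul_sum_mul_char hχ, norm_mul, mul_pow, norm_gaussSum_sq (isPrimitive_inv hχ)]
  have h2 : ∑ χ : DirichletCharacter ℂ q with χ.IsPrimitive, ‖∑ b ∈ range q, χ⁻¹ b * Sb b‖ ^ 2 ≤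
      ∑ χ : DirichletCharacter ℂ q, ‖∑ b ∈ range q, χ⁻¹ b * Sb b‖ ^ 2 :=
    sum_le_sum_of_subset_of_nonneg (filter_subset _ _) fun χ _ _ => by positivity
  have h3 : ∑ χ : DirichletCharacter ℂ q, ‖∑ b ∈ range q, χ⁻¹ b * Sb b‖ ^ 2 =
      q.totient * ∑ b ∈ range q with b.Coprime q, ‖Sb b‖ ^ 2 := by
    rw [← sum_norm_sq_sum_char_mul Sb]
    exact Fintype.sum_equiv (Equiv.inv (DirichletCharacter ℂ q)) _ _ fun χ => rfl
  have hφ : (0 : ℝ) < q.totient := by exact_mod_cast Nat.totient_pos.2 (NeZero.pos q)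
  rw [div_mul_eq_mul_div, div_le_iff₀ hφ, mul_sum]
  calc ∑ χ : DirichletCharacter ℂ q with χ.IsPrimitive, (q : ℝ) * ‖∑ n ∈ S, a n * χ n‖ ^ 2
      = ∑ χ : DirichletCharacter ℂ q with χ.IsPrimitive, ‖∑ b ∈ range q, χ⁻¹ b * Sb b‖ ^ 2 :=
        sum_congr rfl fun χ hχ => h1 χ (mem_filter.1 hχ).2
    _ ≤ _ := h2
    _ = _ := h3
    _ = _ := mul_comm _ _

end GaussSum

/-! ### The large sieve for characters -/

open scoped Classical in
/-- **The large sieve inequality for primitive characters** (Cojocaru–Murty Thm 8.3.1, "first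
modified large sieve inequality" (8.17), there with `z² + 4πx`; Huxley 1972, ch. 18, (18.12):
`(N + O(Q²)) ∑|u(m)|²`; Iwaniec–Kowalski Thm 7.13 with the optimal `Q² + N − 1`): for complex
`a_n` supported on `M₀ < n ≤ M₀ + N`,
`∑_{q ≤ Q} (q/φ(q)) ∑*_{χ mod q} |∑_n a_n χ(n)|² ≤ (N + 1 + 2Q²) ∑_n |a_n|²`
(weak constant, inherited from `largeSieve_farey`). [cite: CojocaruMurty2005, Thm 8.3.1] -/
theorem largeSieve_character (a : ℤ → ℂ) (M₀ : ℤ) (N Q : ℕ) :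
    ∑ q ∈ Icc 1 Q, (q : ℝ) / q.totient *
        ∑ χ : DirichletCharacter ℂ q with χ.IsPrimitive,
          ‖∑ n ∈ Ioc M₀ (M₀ + N), a n * χ n‖ ^ 2 ≤
      ((N : ℝ) + 1 + 2 * (Q : ℝ) ^ 2) * ∑ n ∈ Ioc M₀ (M₀ + N), ‖a n‖ ^ 2 := by
  refine le_trans (sum_le_sum fun q hq => ?_) (largeSieve_farey a M₀ N Q)
  have : NeZero q := ⟨by rw [mem_Icc] at hq; omega⟩
  exact mul_sum_primitive_norm_sq_le _ a

/-- Sums over `(A, A + N] ⊆ ℕ` as sums over the integer interval. [folklore] -/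
theorem sum_Ioc_natCast {A : Type*} [AddCommMonoid A] (f : ℤ → A) (M₀ N : ℕ) :
    ∑ n ∈ Ioc (M₀ : ℤ) (M₀ + N), f n = ∑ n ∈ Ioc M₀ (M₀ + N), f n := by
  refine (Finset.sum_nbij' (fun n : ℕ => (n : ℤ)) (fun m : ℤ => m.toNat) ?_ ?_ ?_ ?_
    (fun _ _ => rfl)).symm
  · intro n hn; rw [mem_Ioc] at hn ⊢; omega
  · intro m hm; rw [mem_Ioc] at hm ⊢; omega
  · intro n _; simp
  · intro m hm; rw [mem_Ioc] at hm; omega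

open scoped Classical in
/-- **The large sieve inequality for primitive characters**, for sequences indexed by natural
numbers `M₀ < n ≤ M₀ + N`. [cite: CojocaruMurty2005, Thm 8.3.1] -/
theorem largeSieve_character_nat (a : ℕ → ℂ) (M₀ N Q : ℕ) :
    ∑ q ∈ Icc 1 Q, (q : ℝ) / q.totient *
        ∑ χ : DirichletCharacter ℂ q with χ.IsPrimitive,
          ‖∑ n ∈ Ioc M₀ (M₀ + N), a n * χ n‖ ^ 2 ≤
      ((N : ℝ) + 1 + 2 * (Q : ℝ) ^ 2) * ∑ n ∈ Ioc M₀ (M₀ + N), ‖a n‖ ^ 2 := by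
  have h := largeSieve_character (fun m : ℤ => a m.toNat) M₀ N Q
  simp only [sum_Ioc_natCast, Int.toNat_natCast, Int.cast_natCast] at h
  exact h

open scoped Classical in
/-- **Vaughan's Lemma 1** (the bilinear large sieve; Vaughan 1980, Lemma 1, from the large sieve
and Cauchy's inequality): for complex `a_m` (`M₀ < m ≤ M₀ + M`) and `b_n` (`N₀ < n ≤ N₀ + N`),
`∑_{q ≤ Q} (q/φ(q)) ∑*_{χ mod q} |∑_m ∑_n a_m b_n χ(mn)|
  ≤ ((M + 1 + 2Q²) ∑_m |a_m|²)^{1/2} ((N + 1 + 2Q²) ∑_n |b_n|²)^{1/2}`.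
[cite: Vaughan1980, Lemma 1] -/
theorem largeSieve_bilinear (a b : ℕ → ℂ) (M₀ M N₀ N Q : ℕ) :
    ∑ q ∈ Icc 1 Q, (q : ℝ) / q.totient *
        ∑ χ : DirichletCharacter ℂ q with χ.IsPrimitive,
          ‖∑ m ∈ Ioc M₀ (M₀ + M), ∑ n ∈ Ioc N₀ (N₀ + N), a m * b n * χ (m * n)‖ ≤
      Real.sqrt (((M : ℝ) + 1 + 2 * (Q : ℝ) ^ 2) * ∑ m ∈ Ioc M₀ (M₀ + M), ‖a m‖ ^ 2) *
        Real.sqrt (((N : ℝ) + 1 + 2 * (Q : ℝ) ^ 2) * ∑ n ∈ Ioc N₀ (N₀ + N), ‖b n‖ ^ 2) := by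
  -- factorisation `∑∑ a_m b_n χ(mn) = (∑ a_m χ(m)) (∑ b_n χ(n))`
  have hfac : ∀ (q : ℕ) (χ : DirichletCharacter ℂ q),
      ∑ m ∈ Ioc M₀ (M₀ + M), ∑ n ∈ Ioc N₀ (N₀ + N), a m * b n * χ (m * n) =
        (∑ m ∈ Ioc M₀ (M₀ + M), a m * χ m) * ∑ n ∈ Ioc N₀ (N₀ + N), b n * χ n := by
    intro q χ
    rw [sum_mul_sum]
    refine sum_congr rfl fun m _ => sum_congr rfl fun n _ => ?_
    rw [map_mul]; ring
  set X : ℕ → ℝ := fun q => (q : ℝ) / q.totient *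
    ∑ χ : DirichletCharacter ℂ q with χ.IsPrimitive, ‖∑ m ∈ Ioc M₀ (M₀ + M), a m * χ m‖ ^ 2 with hX
  set Y : ℕ → ℝ := fun q => (q : ℝ) / q.totient *
    ∑ χ : DirichletCharacter ℂ q with χ.IsPrimitive, ‖∑ n ∈ Ioc N₀ (N₀ + N), b n * χ n‖ ^ 2 with hY
  have hw : ∀ q : ℕ, 0 ≤ (q : ℝ) / q.totient := fun q => by positivity
  have hX0 : ∀ q, 0 ≤ X q := fun q => mul_nonneg (hw q) (sum_nonneg fun _ _ => by positivity)
  have hY0 : ∀ q, 0 ≤ Y q := fun q => mul_nonneg (hw q) (sum_nonneg fun _ _ => by positivity)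
  -- Cauchy–Schwarz in `χ`, then in `q`
  have hinner : ∀ q : ℕ, (q : ℝ) / q.totient *
      ∑ χ : DirichletCharacter ℂ q with χ.IsPrimitive,
        ‖∑ m ∈ Ioc M₀ (M₀ + M), ∑ n ∈ Ioc N₀ (N₀ + N), a m * b n * χ (m * n)‖ ≤
      Real.sqrt (X q) * Real.sqrt (Y q) := by
    intro q
    simp only [hfac, norm_mul]
    refine (mul_le_mul_of_nonneg_left (Real.sum_mul_le_sqrt_mul_sqrt _ _ _) (hw q)).trans ?_
    simp only [hX, hY]
    rw [Real.sqrt_mul (hw q), Real.sqrt_mul (hw q), mul_mul_mul_comm, Real.mul_self_sqrt (hw q)]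
  calc _ ≤ ∑ q ∈ Icc 1 Q, Real.sqrt (X q) * Real.sqrt (Y q) := sum_le_sum fun q _ => hinner q
    _ ≤ Real.sqrt (∑ q ∈ Icc 1 Q, X q) * Real.sqrt (∑ q ∈ Icc 1 Q, Y q) :=
        Real.sum_sqrt_mul_sqrt_le _ hX0 hY0
    _ ≤ _ := by
        gcongr
        · exact largeSieve_character_nat a M₀ M Q
        · exact largeSieve_character_nat b N₀ N Q

/-! ### Geometric sums over intervals and the harmonic majorant of `1/|e(b/q) − 1|` -/

/-- A geometric progression over an interval: `|∑_{A < n ≤ A+N} e(nt)| ≤ 2/|e(t) - 1|`.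
[folklore] -/
theorem norm_sum_Ioc_e_le (A N : ℕ) {t : ℝ} (ht : e t ≠ 1) :
    ‖∑ n ∈ Ioc A (A + N), e (n * t)‖ ≤ 2 / ‖e t - 1‖ := by
  have h : ∑ n ∈ Ioc A (A + N), e (n * t) = e ((A + 1 : ℕ) * t) * ∑ j ∈ range N, e t ^ j := by
    rw [← Finset.Ico_add_one_add_one_eq_Ioc, Finset.sum_Ico_eq_sum_range,
      show A + N + 1 - (A + 1) = N by omega, mul_sum]
    refine sum_congr rfl fun j _ => ?_
    rw [← e_nat_mul, ← e_add]; congr 1; push_cast; ring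
  rw [h, norm_mul, norm_e, one_mul]
  exact norm_geom_sum_le (norm_e t) ht N

/-- For `0 < b < q`: `1/|e(b/q) - 1| = 1/(2 sin(πb/q)) ≤ q/(4b) + q/(4(q - b))` (Jordan's
inequality `sin πu ≥ 2u` on each half of the period). [folklore] -/
theorem inv_norm_e_sub_one_le {q b : ℕ} (hb : 0 < b) (hbq : b < q) :
    ‖e ((b : ℝ) / q) - 1‖⁻¹ ≤ (q : ℝ) / (4 * b) + (q : ℝ) / (4 * (q - b : ℕ)) := by
  have hq : (0 : ℝ) < q := by exact_mod_cast hb.trans hbq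
  have hb' : (0 : ℝ) < b := by exact_mod_cast hb
  have hqb : (0 : ℝ) < (q - b : ℕ) := by exact_mod_cast Nat.sub_pos_of_lt hbq
  have hqb' : ((q - b : ℕ) : ℝ) = q - b := by push_cast [hbq.le]; ring
  rw [norm_e_sub_one]
  have h1 : 0 ≤ (q : ℝ) / (4 * b) := by positivity
  have h2 : 0 ≤ (q : ℝ) / (4 * (q - b : ℕ)) := by positivity
  rcases le_or_gt (2 * b) q with hle | hgt
  · -- `b/q ≤ 1/2`: `sin(π b/q) ≥ 2 b/q`
    have h2b : 2 * (b : ℝ) ≤ q := by exact_mod_cast hle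
    have hs := two_mul_le_sin_pi_mul (u := (b : ℝ) / q) (by positivity)
      (by rw [div_le_iff₀ hq]; linarith)
    have hpos : 0 < 2 * ((b : ℝ) / q) := by positivity
    calc (2 * |Real.sin (π * (b / q))|)⁻¹ ≤ (2 * (2 * ((b : ℝ) / q)))⁻¹ := by
          refine inv_anti₀ (by positivity) ?_
          gcongr
          exact hs.trans (le_abs_self _)
      _ = (q : ℝ) / (4 * b) := by field_simp; ring
      _ ≤ _ := le_add_of_nonneg_right h2
  · -- `b/q > 1/2`: use `sin(π b/q) = sin(π (q-b)/q)`
    have hsymm : Real.sin (π * ((b : ℝ) / q)) = Real.sin (π * ((q - b : ℕ) / q)) := by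
      rw [hqb', sub_div, div_self hq.ne', mul_sub, mul_one, Real.sin_pi_sub]
    have h2b : (q : ℝ) ≤ 2 * b := by exact_mod_cast hgt.le
    have hs := two_mul_le_sin_pi_mul (u := ((q - b : ℕ) : ℝ) / q) (by positivity)
      (by rw [div_le_iff₀ hq, hqb']; linarith)
    have hpos : 0 < 2 * (((q - b : ℕ) : ℝ) / q) := by positivity
    calc (2 * |Real.sin (π * (b / q))|)⁻¹ ≤ (2 * (2 * (((q - b : ℕ) : ℝ) / q)))⁻¹ := by
          refine inv_anti₀ (by positivity) ?_
          rw [hsymm]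
          gcongr
          exact hs.trans (le_abs_self _)
      _ = (q : ℝ) / (4 * (q - b : ℕ)) := by field_simp; ring
      _ ≤ _ := le_add_of_nonneg_left h1

/-- `∑_{0 < b < q} (q/(4b) + q/(4(q-b))) = (q/2) H_{q-1} ≤ (q/2)(1 + log q)`. [folklore] -/
theorem sum_Ioo_div_add_div_le (q : ℕ) :
    ∑ b ∈ Ioo 0 q, ((q : ℝ) / (4 * b) + (q : ℝ) / (4 * (q - b : ℕ))) ≤
      (q : ℝ) / 2 * (1 + Real.log q) := by
  have hH : ∑ b ∈ Ioo 0 q, ((b : ℝ))⁻¹ ≤ 1 + Real.log q := by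
    have h1 : ∑ b ∈ Ioo 0 q, ((b : ℝ))⁻¹ ≤ ∑ b ∈ Icc 1 q, ((b : ℝ))⁻¹ :=
      sum_le_sum_of_subset_of_nonneg (fun b hb => by
        rw [mem_Ioo] at hb; rw [mem_Icc]; omega) fun _ _ _ => by positivity
    refine h1.trans ?_
    have h2 : ∑ b ∈ Icc 1 q, ((b : ℝ))⁻¹ = harmonic q := by
      rw [harmonic_eq_sum_Icc]; push_cast; rfl
    rw [h2]
    have := harmonic_le_one_add_log q
    exact_mod_cast this
  have hreflect : ∑ b ∈ Ioo 0 q, ((q - b : ℕ) : ℝ)⁻¹ = ∑ b ∈ Ioo 0 q, ((b : ℝ))⁻¹ := by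
    refine Finset.sum_nbij' (fun b => q - b) (fun b => q - b) ?_ ?_ ?_ ?_ (fun _ _ => rfl)
    · intro b hb; rw [mem_Ioo] at hb ⊢; omega
    · intro b hb; rw [mem_Ioo] at hb ⊢; omega
    · intro b hb; rw [mem_Ioo] at hb; omega
    · intro b hb; rw [mem_Ioo] at hb; omega
  have hsplit : ∀ b : ℕ, (q : ℝ) / (4 * b) + (q : ℝ) / (4 * (q - b : ℕ)) =
      (q : ℝ) / 4 * ((b : ℝ))⁻¹ + (q : ℝ) / 4 * ((q - b : ℕ) : ℝ)⁻¹ := fun b => by ring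
  simp only [hsplit, sum_add_distrib, ← mul_sum, hreflect]
  nlinarith [hH, (by positivity : (0 : ℝ) ≤ q)]

/-! ### The Pólya–Vinogradov inequality for primitive characters -/

/-- **The Pólya–Vinogradov inequality for primitive characters** (Pólya, Schur 1918;
Cojocaru–Murty (8.14): `≪ d^{1/2} log d` for non-trivial `χ mod d`; Davenport ch. 23): for `χ`
primitive mod `q ≥ 2` and any interval `(A, A + N]`, `|∑_{A < n ≤ A+N} χ(n)| ≤ √q (1 + log q)`.
(From the Gauss-sum expansion `sum_inv_mul_e_eq`, the geometric sums `|∑_n e(bn/q)| ≤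
1/sin(πb/q)` and `∑_{0<b<q} 1/sin(πb/q) ≤ q H_{q−1}`; only the primitive case is needed for
Vaughan's mean value theorem.) [cite: CojocaruMurty2005, (8.14)] -/
theorem polyaVinogradov {q : ℕ} (hq : 2 ≤ q) {χ : DirichletCharacter ℂ q} (hχ : χ.IsPrimitive)
    (A N : ℕ) :
    ‖∑ n ∈ Ioc A (A + N), χ n‖ ≤ Real.sqrt q * (1 + Real.log q) := by
  have : NeZero q := ⟨by omega⟩
  have hq0 : (0 : ℝ) < q := by exact_mod_cast (by omega : 0 < q)
  -- Gauss sum expansion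
  have hexp := gaussSum_mul_sum_mul_char hχ ((Ioc A (A + N)).map Nat.castEmbedding) (fun _ => 1)
  simp only [one_mul, sum_map, Nat.castEmbedding_apply, Int.cast_natCast] at hexp
  -- `hexp : τ(χ⁻¹) * ∑ χ n = ∑ b, χ⁻¹ b * ∑ n, e(b n / q)`
  have hτ : ‖gaussSum χ⁻¹ ZMod.stdAddChar‖ = Real.sqrt q := by
    rw [← Real.sqrt_sq (norm_nonneg _), norm_gaussSum_sq (isPrimitive_inv hχ)]
  -- the `b = 0` term vanishes (`χ⁻¹ 0 = 0` as `q ≥ 2`), the others are geometric sums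
  have hχ0 : χ⁻¹ ((0 : ℕ) : ZMod q) = 0 := by
    haveI : Fact (1 < q) := ⟨hq⟩
    rw [Nat.cast_zero, MulChar.map_zero]
  have hterm : ∀ b ∈ Ioo 0 q, ‖χ⁻¹ b * ∑ n ∈ Ioc A (A + N), e ((b : ℝ) * (n : ℕ) / q)‖ ≤
      2 * ((q : ℝ) / (4 * b) + (q : ℝ) / (4 * (q - b : ℕ))) := by
    intro b hb
    rw [mem_Ioo] at hb
    obtain ⟨hb0, hbq⟩ := hb
    have hne : e ((b : ℝ) / q) ≠ 1 := by
      intro h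
      have h1 : ‖e ((b : ℝ) / q) - 1‖ = 0 := by rw [h, sub_self, norm_zero]
      rw [norm_e_sub_one] at h1
      have hs : Real.sin (π * ((b : ℝ) / q)) = 0 := by
        have := abs_eq_zero.1 (by linarith [abs_nonneg (Real.sin (π * ((b : ℝ) / q)))] :
          |Real.sin (π * ((b : ℝ) / q))| = 0)
        exact this
      have hpos : 0 < Real.sin (π * ((b : ℝ) / q)) := by
        refine Real.sin_pos_of_pos_of_lt_pi (by positivity) ?_
        calc π * ((b : ℝ) / q) < π * 1 := by
              gcongr; rw [div_lt_one hq0]; exact_mod_cast hbq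
          _ = π := mul_one π
      linarith
    have hgeom : ‖∑ n ∈ Ioc A (A + N), e ((b : ℝ) * (n : ℕ) / q)‖ ≤ 2 / ‖e ((b : ℝ) / q) - 1‖ := by
      have := norm_sum_Ioc_e_le A N hne
      refine le_of_eq_of_le (congr_arg _ (sum_congr rfl fun n _ => ?_)) this
      congr 1; ring
    rw [norm_mul]
    calc ‖χ⁻¹ (b : ZMod q)‖ * ‖∑ n ∈ Ioc A (A + N), e ((b : ℝ) * (n : ℕ) / q)‖
        ≤ 1 * (2 / ‖e ((b : ℝ) / q) - 1‖) :=
          mul_le_mul (DirichletCharacter.norm_le_one _ _) hgeom (norm_nonneg _) zero_le_one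
      _ = 2 * ‖e ((b : ℝ) / q) - 1‖⁻¹ := by rw [one_mul, div_eq_mul_inv]
      _ ≤ 2 * ((q : ℝ) / (4 * b) + (q : ℝ) / (4 * (q - b : ℕ))) :=
          mul_le_mul_of_nonneg_left (inv_norm_e_sub_one_le hb0 hbq) zero_le_two
  -- assemble
  have hsum : ‖∑ b ∈ range q, χ⁻¹ b * ∑ n ∈ Ioc A (A + N), e ((b : ℝ) * (n : ℕ) / q)‖ ≤
      q * (1 + Real.log q) := by
    have hr : range q = insert 0 (Ioo 0 q) := by
      ext b; simp only [mem_range, mem_insert, mem_Ioo]; omega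
    rw [hr, sum_insert (by simp), hχ0, zero_mul, zero_add]
    refine (norm_sum_le _ _).trans ((sum_le_sum hterm).trans ?_)
    rw [← mul_sum]
    have := sum_Ioo_div_add_div_le q
    nlinarith [this, hq0]
  have hfin : Real.sqrt q * ‖∑ n ∈ Ioc A (A + N), χ n‖ ≤ q * (1 + Real.log q) := by
    rw [← hτ, ← norm_mul, hexp]; exact hsum
  have hsq : (0 : ℝ) < Real.sqrt q := Real.sqrt_pos.2 hq0
  calc ‖∑ n ∈ Ioc A (A + N), χ n‖
      = (Real.sqrt q * ‖∑ n ∈ Ioc A (A + N), χ n‖) / Real.sqrt q := by field_simp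
    _ ≤ q * (1 + Real.log q) / Real.sqrt q := by gcongr
    _ = Real.sqrt q * (1 + Real.log q) := by
        rw [div_eq_iff hsq.ne', mul_right_comm, Real.mul_self_sqrt hq0.le]

/-! ### Separation of variables in the hyperbolic cutoff `mn ≤ X`

Vaughan (1980, Lemma 2) removes the condition `mn ≤ X` from a bilinear form with the truncated
Perron-type integral `δ(β) = ∫_{-A}^{A} e^{iβα} (sin γα)/(Cα) dα + O(A⁻¹|γ − β|⁻¹)`. We use a
purely arithmetic substitute with the same effect (one logarithm lost): on the logarithmic scale
`u(m) = ⌊T log m⌋` with `T = 4(Y + 1)` the condition `mn ≤ X` (`X ≤ Y`) is *equivalent* to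
`u(m) + u(n) ≤ Z(X)`, `Z(X) = ⌊T log(X + 1/2)⌋` (the values `log(mn)` avoid a neighbourhood of
size `≍ 1/X` of `log(X + 1/2)`, and the discretisation errors are `< 2/T`), and the indicator of
`w ≤ Z` on `{0, …, P − 1}` has the finite Fourier expansion `∑_{k mod P} c_k e(kw/P)` with
`∑_k |c_k| ≤ 2 + log P`. -/

section Separation

/-- The logarithmic scale `u_T(m) = ⌊T log m⌋`. [folklore] -/
noncomputable def ulog (T m : ℕ) : ℕ := ⌊(T : ℝ) * Real.log m⌋₊

/-- The threshold `Z_T(X) = ⌊T log(X + 1/2)⌋`. [folklore] -/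
noncomputable def zlog (T X : ℕ) : ℕ := ⌊(T : ℝ) * Real.log (X + 1 / 2)⌋₊

/-- `u_T` is monotone. [folklore] -/
theorem ulog_mono (T : ℕ) {m m' : ℕ} (h : m ≤ m') : ulog T m ≤ ulog T m' := by
  unfold ulog
  rcases Nat.eq_zero_or_pos m with rfl | hm
  · simp
  · exact Nat.floor_le_floor (mul_le_mul_of_nonneg_left
      (Real.log_le_log (by exact_mod_cast hm) (by exact_mod_cast h)) (Nat.cast_nonneg T))

/-- `log(1 + 1/x) ≥ 1/(x + 1)` for `x > 0`. [folklore] -/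
theorem inv_add_one_le_log {x : ℝ} (hx : 0 < x) : (x + 1)⁻¹ ≤ Real.log (1 + x⁻¹) := by
  have h := Real.log_le_sub_one_of_pos (x := x / (x + 1)) (by positivity)
  have e1 : Real.log (x / (x + 1)) = -Real.log (1 + x⁻¹) := by
    rw [← Real.log_inv]; congr 1; field_simp
  have e2 : x / (x + 1) - 1 = -(x + 1)⁻¹ := by field_simp; ring
  rw [e1, e2] at h
  linarith

/-- **Exact separation of `mn ≤ X` on the logarithmic scale**: for `1 ≤ m, n`, `1 ≤ X` and
`T ≥ 4(X + 1)`, `mn ≤ X ↔ u_T(m) + u_T(n) ≤ Z_T(X)`. [folklore] -/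
theorem mul_le_iff_ulog_add_ulog_le {T X m n : ℕ} (hT : 4 * (X + 1) ≤ T) (hX : 1 ≤ X)
    (hm : 1 ≤ m) (hn : 1 ≤ n) : m * n ≤ X ↔ ulog T m + ulog T n ≤ zlog T X := by
  have hX' : (1 : ℝ) ≤ X := by exact_mod_cast hX
  have hT' : 4 * ((X : ℝ) + 1) ≤ T := by exact_mod_cast hT
  have hm' : (1 : ℝ) ≤ m := by exact_mod_cast hm
  have hn' : (1 : ℝ) ≤ n := by exact_mod_cast hn
  have hlm : 0 ≤ Real.log m := Real.log_nonneg hm'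
  have hln : 0 ≤ Real.log n := Real.log_nonneg hn'
  have hT0 : (0 : ℝ) ≤ T := Nat.cast_nonneg T
  have hum : (ulog T m : ℝ) ≤ T * Real.log m := Nat.floor_le (by positivity)
  have hun : (ulog T n : ℝ) ≤ T * Real.log n := Nat.floor_le (by positivity)
  have hum' : (T : ℝ) * Real.log m < ulog T m + 1 := Nat.lt_floor_add_one _
  have hun' : (T : ℝ) * Real.log n < ulog T n + 1 := Nat.lt_floor_add_one _
  have hlogmn : Real.log ((m * n : ℕ) : ℝ) = Real.log m + Real.log n := by
    push_cast; exact Real.log_mul (by positivity) (by positivity)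
  have hZpos : 0 ≤ (T : ℝ) * Real.log (X + 1 / 2) :=
    mul_nonneg hT0 (Real.log_nonneg (by linarith))
  have hZ : (zlog T X : ℝ) ≤ T * Real.log (X + 1 / 2) := Nat.floor_le hZpos
  have hZ' : (T : ℝ) * Real.log (X + 1 / 2) < zlog T X + 1 := Nat.lt_floor_add_one _
  -- the two gaps: `T (log(X + 1/2) − log X) ≥ 1` and `T (log(X + 1) − log(X + 1/2)) ≥ 2`
  have hgap1 : 1 ≤ (T : ℝ) * (Real.log (X + 1 / 2) - Real.log X) := by
    have h1 : ((2 : ℝ) * X + 1)⁻¹ ≤ Real.log (X + 1 / 2) - Real.log X := by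
      rw [← Real.log_div (by linarith) (by linarith)]
      have := inv_add_one_le_log (x := 2 * (X : ℝ)) (by linarith)
      convert this using 2
      · field_simp
    calc (1 : ℝ) ≤ 4 * ((X : ℝ) + 1) * ((2 : ℝ) * X + 1)⁻¹ := by
          rw [le_mul_inv_iff₀ (by linarith)]; linarith
      _ ≤ T * (Real.log (X + 1 / 2) - Real.log X) :=
          mul_le_mul hT' h1 (by positivity) hT0
  have hgap2 : 2 ≤ (T : ℝ) * (Real.log (X + 1) - Real.log (X + 1 / 2)) := by
    have h1 : ((2 : ℝ) * X + 2)⁻¹ ≤ Real.log (X + 1) - Real.log (X + 1 / 2) := by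
      rw [← Real.log_div (by linarith) (by linarith)]
      have := inv_add_one_le_log (x := 2 * (X : ℝ) + 1) (by linarith)
      convert this using 2
      · ring
      · field_simp; ring
    calc (2 : ℝ) = 4 * ((X : ℝ) + 1) * ((2 : ℝ) * X + 2)⁻¹ := by field_simp; ring
      _ ≤ T * (Real.log (X + 1) - Real.log (X + 1 / 2)) :=
          mul_le_mul hT' h1 (by positivity) hT0
  constructor
  · intro h
    have h' : Real.log m + Real.log n ≤ Real.log X := by
      rw [← hlogmn]; exact Real.log_le_log (by positivity) (by exact_mod_cast h)
    have : ((ulog T m + ulog T n : ℕ) : ℝ) < zlog T X := by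
      push_cast
      nlinarith
    exact_mod_cast this.le
  · intro h
    by_contra hlt
    push Not at hlt
    have h' : Real.log (X + 1) ≤ Real.log m + Real.log n := by
      rw [← hlogmn]; exact Real.log_le_log (by linarith) (by exact_mod_cast hlt)
    have h2 : ((ulog T m + ulog T n : ℕ) : ℝ) ≤ zlog T X := by exact_mod_cast h
    push_cast at h2
    nlinarith

/-- The modulus of the finite Fourier expansion: `P = u_T(M₁) + u_T(N₁) + 1` exceeds
`u_T(m) + u_T(n)` for all `m ≤ M₁`, `n ≤ N₁`. [folklore] -/
noncomputable def sepModulus (T M₁ N₁ : ℕ) : ℕ := ulog T M₁ + ulog T N₁ + 1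

/-- `u(m) + u(n) < P` on the box. [folklore] -/
theorem ulog_add_ulog_lt_sepModulus (T : ℕ) {M₁ N₁ m n : ℕ} (hm : m ≤ M₁) (hn : n ≤ N₁) :
    ulog T m + ulog T n < sepModulus T M₁ N₁ := by
  unfold sepModulus
  have := ulog_mono T hm
  have := ulog_mono T hn
  omega

/-- `1 ≤ P`. [folklore] -/
theorem sepModulus_pos (T M₁ N₁ : ℕ) : 0 < sepModulus T M₁ N₁ := Nat.succ_pos _

/-- A crude size bound for the modulus: `P ≤ (T + 1) M₁ N₁` for `1 ≤ M₁, N₁` (so that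
`log P ≤ log(T + 1) + log M₁ + log N₁`). [folklore] -/
theorem sepModulus_le {T M₁ N₁ : ℕ} (hM : 1 ≤ M₁) (hN : 1 ≤ N₁) :
    (sepModulus T M₁ N₁ : ℝ) ≤ (T + 1) * (M₁ * N₁) := by
  unfold sepModulus ulog
  have hM' : (1 : ℝ) ≤ M₁ := by exact_mod_cast hM
  have hN' : (1 : ℝ) ≤ N₁ := by exact_mod_cast hN
  have hT0 : (0 : ℝ) ≤ T := Nat.cast_nonneg T
  have h1 : (⌊(T : ℝ) * Real.log M₁⌋₊ : ℝ) ≤ T * Real.log M₁ :=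
    Nat.floor_le (mul_nonneg hT0 (Real.log_nonneg hM'))
  have h2 : (⌊(T : ℝ) * Real.log N₁⌋₊ : ℝ) ≤ T * Real.log N₁ :=
    Nat.floor_le (mul_nonneg hT0 (Real.log_nonneg hN'))
  have h3 : Real.log M₁ ≤ M₁ - 1 := Real.log_le_sub_one_of_pos (by linarith)
  have h4 : Real.log N₁ ≤ N₁ - 1 := Real.log_le_sub_one_of_pos (by linarith)
  push_cast
  nlinarith [mul_nonneg (sub_nonneg.2 hM') (sub_nonneg.2 hN'), mul_nonneg hT0 (sub_nonneg.2 hM'),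
    mul_nonneg hT0 (sub_nonneg.2 hN')]

/-! #### Finite Fourier expansion of an initial segment of `ℤ/Pℤ` -/

/-- Orthogonality of the additive characters of `ℤ/Pℤ`: for an integer `|d| < P`,
`∑_{k < P} e(kd/P) = P [d = 0]`. [folklore] -/
theorem sum_range_e_mul_div {P : ℕ} (hP : 0 < P) {d : ℤ} (hd : |d| < P) :
    ∑ k ∈ range P, e ((k : ℝ) * d / P) = if d = 0 then (P : ℂ) else 0 := by
  have hP' : (0 : ℝ) < P := by exact_mod_cast hP
  split_ifs with h0
  · subst h0; simp [e_zero]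
  · have hgeom : ∀ k ∈ range P, e ((k : ℝ) * d / P) = e ((d : ℝ) / P) ^ k := fun k _ => by
      rw [← e_nat_mul]; congr 1; ring
    have hne : e ((d : ℝ) / P) ≠ 1 := by
      intro h
      have h1 : ‖e ((d : ℝ) / P) - 1‖ = 0 := by rw [h, sub_self, norm_zero]
      rw [norm_e_sub_one, mul_eq_zero, abs_eq_zero] at h1
      rcases h1 with h1 | h1
      · norm_num at h1
      · rw [Real.sin_eq_zero_iff_of_lt_of_lt] at h1
        · have : (d : ℝ) = 0 := by
            rcases mul_eq_zero.1 h1 with h2 | h2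
            · exact absurd h2 Real.pi_ne_zero
            · rwa [div_eq_zero_iff, or_iff_left hP'.ne'] at h2
          exact h0 (by exact_mod_cast this)
        · have hd' : (-(P : ℝ)) < d := by
            have := (abs_lt.1 hd).1; exact_mod_cast this
          calc -π = π * (-(P : ℝ) / P) := by field_simp
            _ < π * ((d : ℝ) / P) := by gcongr
        · have hd' : (d : ℝ) < P := by
            have := (abs_lt.1 hd).2; exact_mod_cast this
          calc π * ((d : ℝ) / P) < π * ((P : ℝ) / P) := by gcongr
            _ = π := by field_simp
    have hpow : e ((d : ℝ) / P) ^ P = 1 := by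
      rw [← e_nat_mul, show (P : ℝ) * ((d : ℝ) / P) = (d : ℤ) by field_simp, e_int]
    rw [sum_congr rfl hgeom, geom_sum_eq hne, hpow, sub_self, zero_div]

/-- The Fourier coefficients `c_k = P⁻¹ ∑_{z ≤ Z'} e(−kz/P)` of the indicator of `[0, Z']`.
[folklore] -/
noncomputable def sepCoeff (P Z' k : ℕ) : ℂ :=
  (P : ℂ)⁻¹ * ∑ z ∈ range (Z' + 1), e (-((k : ℝ) * z / P))

/-- **Finite Fourier expansion of an initial segment**: for `w, Z' < P`,
`[w ≤ Z'] = ∑_{k < P} e(kw/P) c_k`. [folklore] -/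
theorem ite_le_eq_sum_e_mul_sepCoeff {P w Z' : ℕ} (hw : w < P) (hZ : Z' < P) :
    (if w ≤ Z' then (1 : ℂ) else 0) = ∑ k ∈ range P, e ((k : ℝ) * w / P) * sepCoeff P Z' k := by
  have hP : 0 < P := by omega
  have hP' : (P : ℂ) ≠ 0 := by exact_mod_cast hP.ne'
  -- swap the sums and use orthogonality
  have h1 : ∑ k ∈ range P, e ((k : ℝ) * w / P) * sepCoeff P Z' k =
      (P : ℂ)⁻¹ * ∑ z ∈ range (Z' + 1), ∑ k ∈ range P, e ((k : ℝ) * ((w : ℤ) - z : ℤ) / P) := by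
    have e1 : ∀ k ∈ range P, e ((k : ℝ) * w / P) * sepCoeff P Z' k =
        (P : ℂ)⁻¹ * ∑ z ∈ range (Z' + 1), e ((k : ℝ) * ((w : ℤ) - z : ℤ) / P) := by
      intro k _
      rw [sepCoeff, mul_left_comm, mul_sum]
      congr 1
      refine sum_congr rfl fun z _ => ?_
      rw [← e_add]; congr 1; push_cast; ring
    rw [sum_congr rfl e1, ← mul_sum, sum_comm]
  have h2 : ∀ z ∈ range (Z' + 1), ∑ k ∈ range P, e ((k : ℝ) * ((w : ℤ) - z : ℤ) / P) =
      if (w : ℤ) - z = 0 then (P : ℂ) else 0 := by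
    intro z hz
    refine sum_range_e_mul_div hP ?_
    rw [mem_range] at hz
    rw [abs_lt]; constructor <;> omega
  rw [h1, sum_congr rfl h2]
  have h3 : ∀ z ∈ range (Z' + 1), (if (w : ℤ) - z = 0 then (P : ℂ) else 0) =
      if w = z then (P : ℂ) else 0 := by
    intro z _
    congr 1
    simp only [sub_eq_zero, Int.natCast_inj]
  rw [sum_congr rfl h3, sum_ite_eq]
  split_ifs with h4 h5 h5
  · rw [inv_mul_cancel₀ hP']
  · exfalso; exact h5 (mem_range.2 (by omega))
  · exfalso; rw [mem_range] at h5; omega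
  · rw [mul_zero]

/-- The majorant `γ_k` of `|c_k|`: `γ_0 = 1`, `γ_k = (2/P)(P/(4k) + P/(4(P − k)))` else.
[folklore] -/
noncomputable def sepWeight (P k : ℕ) : ℝ :=
  if k = 0 then 1 else 2 / P * ((P : ℝ) / (4 * k) + (P : ℝ) / (4 * (P - k : ℕ)))

/-- `γ_k ≥ 0`. [folklore] -/
theorem sepWeight_nonneg (P k : ℕ) : 0 ≤ sepWeight P k := by
  unfold sepWeight; split_ifs <;> positivity

/-- `|c_k| ≤ γ_k` for `k < P`, `Z' < P`. [folklore] -/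
theorem norm_sepCoeff_le {P Z' k : ℕ} (hk : k < P) (hZ : Z' < P) :
    ‖sepCoeff P Z' k‖ ≤ sepWeight P k := by
  have hP : 0 < P := by omega
  have hP' : (0 : ℝ) < P := by exact_mod_cast hP
  unfold sepCoeff sepWeight
  rw [norm_mul, norm_inv, Complex.norm_natCast]
  split_ifs with h0
  · subst h0
    simp only [Nat.cast_zero, zero_mul, zero_div, neg_zero, e_zero, sum_const, card_range,
      nsmul_eq_mul, mul_one, Complex.norm_natCast]
    rw [inv_mul_le_iff₀ hP', mul_one]
    exact_mod_cast hZ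
  · have hk0 : 0 < k := Nat.pos_of_ne_zero h0
    have hgeom : ∀ z ∈ range (Z' + 1), e (-((k : ℝ) * z / P)) = e (-((k : ℝ) / P)) ^ z := by
      intro z _; rw [← e_nat_mul]; congr 1; ring
    have hne : e (-((k : ℝ) / P)) ≠ 1 := by
      intro h
      have h1 : ‖e (-((k : ℝ) / P)) - 1‖ = 0 := by rw [h, sub_self, norm_zero]
      rw [norm_e_neg_sub_one, norm_e_sub_one] at h1
      have hpos : 0 < Real.sin (π * ((k : ℝ) / P)) := by
        refine Real.sin_pos_of_pos_of_lt_pi (by positivity) ?_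
        calc π * ((k : ℝ) / P) < π * 1 := by
              gcongr; rw [div_lt_one hP']; exact_mod_cast hk
          _ = π := mul_one π
      have : |Real.sin (π * ((k : ℝ) / P))| = 0 := by
        linarith [abs_nonneg (Real.sin (π * ((k : ℝ) / P)))]
      rw [abs_eq_zero] at this
      linarith
    rw [sum_congr rfl hgeom]
    calc (P : ℝ)⁻¹ * ‖∑ z ∈ range (Z' + 1), e (-((k : ℝ) / P)) ^ z‖
        ≤ (P : ℝ)⁻¹ * (2 / ‖e (-((k : ℝ) / P)) - 1‖) :=
          mul_le_mul_of_nonneg_left (norm_geom_sum_le (norm_e _) hne _) (by positivity)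
      _ = 2 / P * ‖e ((k : ℝ) / P) - 1‖⁻¹ := by rw [norm_e_neg_sub_one]; ring
      _ ≤ 2 / P * ((P : ℝ) / (4 * k) + (P : ℝ) / (4 * (P - k : ℕ))) :=
          mul_le_mul_of_nonneg_left (inv_norm_e_sub_one_le hk0 hk) (by positivity)

/-- `∑_{k < P} γ_k ≤ 2 + log P`. [folklore] -/
theorem sum_sepWeight_le {P : ℕ} (hP : 0 < P) :
    ∑ k ∈ range P, sepWeight P k ≤ 2 + Real.log P := by
  have hP' : (0 : ℝ) < P := by exact_mod_cast hP
  have hr : range P = insert 0 (Ioo 0 P) := by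
    ext b; simp only [mem_range, mem_insert, mem_Ioo]; omega
  rw [hr, sum_insert (by simp)]
  have h0 : sepWeight P 0 = 1 := by simp [sepWeight]
  have h1 : ∀ k ∈ Ioo 0 P, sepWeight P k =
      2 / P * ((P : ℝ) / (4 * k) + (P : ℝ) / (4 * (P - k : ℕ))) := by
    intro k hk; rw [mem_Ioo] at hk; simp [sepWeight, hk.1.ne']
  rw [h0, sum_congr rfl h1, ← mul_sum]
  have h2 := sum_Ioo_div_add_div_le P
  have hlog : 0 ≤ Real.log P := Real.log_nonneg (by exact_mod_cast hP)
  calc 1 + 2 / (P : ℝ) * ∑ k ∈ Ioo 0 P, ((P : ℝ) / (4 * k) + (P : ℝ) / (4 * (P - k : ℕ)))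
      ≤ 1 + 2 / (P : ℝ) * ((P : ℝ) / 2 * (1 + Real.log P)) := by gcongr
    _ = 2 + Real.log P := by field_simp; ring

end Separation

/-! ### Vaughan's Lemma 2: bilinear forms with the cutoff `mn ≤ X`, uniformly in `X ≤ Y` -/

section Hyperbolic

variable (a b : ℕ → ℂ) (M₀ M N₀ N : ℕ)

/-- The twisted coefficients `a_m e(k u(m)/P)`. [folklore] -/
noncomputable def twist (T P k : ℕ) (a : ℕ → ℂ) (m : ℕ) : ℂ :=
  a m * e ((k : ℝ) * ulog T m / P)

/-- `|a_m e(·)| = |a_m|`. [folklore] -/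
theorem norm_twist (T P k : ℕ) (a : ℕ → ℂ) (m : ℕ) : ‖twist T P k a m‖ = ‖a m‖ := by
  rw [twist, norm_mul, norm_e, mul_one]

/-- **Pointwise separation**: for `1 ≤ X`, `T ≥ 4(X + 1)`, any modulus
`P ≥ sepModulus T (M₀+M) (N₀+N)` and `Z' = min (Z_T(X)) (P - 1)`, the cut-off bilinear form is a
combination of `P` complete bilinear forms with twisted coefficients:
`∑_{m,n, mn ≤ X} a_m b_n χ(mn) = ∑_{k<P} c_k ∑_m ∑_n (a_m e(ku(m)/P)) (b_n e(ku(n)/P)) χ(mn)`.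
[folklore] -/
theorem sum_sum_ite_mul_le_eq {T X P : ℕ} (hX1 : 1 ≤ X) (hT : 4 * (X + 1) ≤ T)
    (hP : sepModulus T (M₀ + M) (N₀ + N) ≤ P) {q : ℕ} (χ : DirichletCharacter ℂ q) :
    ∑ m ∈ Ioc M₀ (M₀ + M), ∑ n ∈ Ioc N₀ (N₀ + N),
        (if m * n ≤ X then a m * b n * χ (m * n) else 0) =
      ∑ k ∈ range P, sepCoeff P (min (zlog T X) (P - 1)) k *
        ∑ m ∈ Ioc M₀ (M₀ + M), ∑ n ∈ Ioc N₀ (N₀ + N),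
          twist T P k a m * twist T P k b n * χ (m * n) := by
  set Z' := min (zlog T X) (P - 1) with hZ'def
  have hP0 : 0 < P := lt_of_lt_of_le (sepModulus_pos _ _ _) hP
  have hZ' : Z' < P := by omega
  -- expand each indicator
  have hterm : ∀ m ∈ Ioc M₀ (M₀ + M), ∀ n ∈ Ioc N₀ (N₀ + N),
      (if m * n ≤ X then a m * b n * χ (m * n) else 0) =
        ∑ k ∈ range P, sepCoeff P Z' k * (twist T P k a m * twist T P k b n * χ (m * n)) := by
    intro m hm n hn
    rw [mem_Ioc] at hm hn
    have hw : ulog T m + ulog T n < P :=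
      lt_of_lt_of_le (ulog_add_ulog_lt_sepModulus T hm.2 hn.2) hP
    have hiff : m * n ≤ X ↔ ulog T m + ulog T n ≤ Z' := by
      rw [mul_le_iff_ulog_add_ulog_le hT hX1 (by omega) (by omega)]
      constructor
      · intro h; exact le_min h (by omega)
      · intro h; exact h.trans (min_le_left _ _)
    have hind := ite_le_eq_sum_e_mul_sepCoeff hw hZ'
    calc (if m * n ≤ X then a m * b n * χ (m * n) else 0)
        = (if ulog T m + ulog T n ≤ Z' then (1 : ℂ) else 0) * (a m * b n * χ (m * n)) := by
          by_cases h : m * n ≤ X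
          · rw [if_pos h, if_pos (hiff.1 h), one_mul]
          · rw [if_neg h, if_neg (mt hiff.2 h), zero_mul]
      _ = ∑ k ∈ range P, e ((k : ℝ) * (ulog T m + ulog T n : ℕ) / P) * sepCoeff P Z' k *
            (a m * b n * χ (m * n)) := by rw [hind, sum_mul]
      _ = _ := by
          refine sum_congr rfl fun k _ => ?_
          rw [twist, twist, show ((k : ℝ) * (ulog T m + ulog T n : ℕ) / P) =
            (k : ℝ) * ulog T m / P + (k : ℝ) * ulog T n / P by push_cast; ring, e_add]
          ring
  rw [sum_congr rfl fun m hm => sum_congr rfl fun n hn => hterm m hm n hn]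
  symm
  calc ∑ k ∈ range P, sepCoeff P Z' k * ∑ m ∈ Ioc M₀ (M₀ + M), ∑ n ∈ Ioc N₀ (N₀ + N),
          twist T P k a m * twist T P k b n * χ (m * n)
      = ∑ k ∈ range P, ∑ m ∈ Ioc M₀ (M₀ + M), ∑ n ∈ Ioc N₀ (N₀ + N),
          sepCoeff P Z' k * (twist T P k a m * twist T P k b n * χ (m * n)) := by
        refine sum_congr rfl fun k _ => ?_
        rw [mul_sum]
        exact sum_congr rfl fun m _ => by rw [mul_sum]
    _ = ∑ m ∈ Ioc M₀ (M₀ + M), ∑ k ∈ range P, ∑ n ∈ Ioc N₀ (N₀ + N),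
          sepCoeff P Z' k * (twist T P k a m * twist T P k b n * χ (m * n)) := sum_comm
    _ = _ := sum_congr rfl fun m _ => sum_comm

/-- **Pointwise majorant**: for every `X` with `4(X + 1) ≤ T` and `P ≥ sepModulus T (M₀+M) (N₀+N)`,
`|∑_{mn ≤ X} a_m b_n χ(mn)| ≤ ∑_{k<P} γ_k |∑_m ∑_n a^{(k)}_m b^{(k)}_n χ(mn)|`. [folklore] -/
theorem norm_sum_sum_ite_mul_le_le {T X P : ℕ} (hT : 4 * (X + 1) ≤ T)
    (hP : sepModulus T (M₀ + M) (N₀ + N) ≤ P) {q : ℕ} (χ : DirichletCharacter ℂ q) :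
    ‖∑ m ∈ Ioc M₀ (M₀ + M), ∑ n ∈ Ioc N₀ (N₀ + N),
        (if m * n ≤ X then a m * b n * χ (m * n) else 0)‖ ≤
      ∑ k ∈ range P, sepWeight P k *
        ‖∑ m ∈ Ioc M₀ (M₀ + M), ∑ n ∈ Ioc N₀ (N₀ + N),
          twist T P k a m * twist T P k b n * χ (m * n)‖ := by
  have hP0 : 0 < P := lt_of_lt_of_le (sepModulus_pos _ _ _) hP
  rcases Nat.eq_zero_or_pos X with rfl | hX1
  · -- `mn ≤ 0` never happens
    have h0 : ∀ m ∈ Ioc M₀ (M₀ + M), ∀ n ∈ Ioc N₀ (N₀ + N),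
        (if m * n ≤ 0 then a m * b n * χ (m * n) else 0) = 0 := by
      intro m hm n hn
      rw [mem_Ioc] at hm hn
      rw [if_neg]
      have : 1 ≤ m * n := Nat.one_le_iff_ne_zero.2 (Nat.mul_ne_zero (by omega) (by omega))
      omega
    rw [sum_congr rfl fun m hm => sum_congr rfl fun n hn => h0 m hm n hn]
    simp only [sum_const_zero, norm_zero]
    exact sum_nonneg fun k _ => mul_nonneg (sepWeight_nonneg _ _) (norm_nonneg _)
  · rw [sum_sum_ite_mul_le_eq a b M₀ M N₀ N hX1 hT hP χ]
    refine (norm_sum_le _ _).trans (sum_le_sum fun k hk => ?_)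
    rw [norm_mul]
    exact mul_le_mul_of_nonneg_right (norm_sepCoeff_le (mem_range.1 hk) (by omega))
      (norm_nonneg _)

open scoped Classical in
/-- **Vaughan's Lemma 2** (bilinear large sieve with the hyperbolic cut-off, uniformly in the
cut-off; Vaughan 1980, Lemma 2, there with the factor `log(YMN)` from a truncated Perron
integral): for complex `a_m` (`M₀ < m ≤ M₀ + M`), `b_n` (`N₀ < n ≤ N₀ + N`) and any choice of
integer cut-offs `X(q, χ) ≤ Y`,
`∑_{q ≤ Q} (q/φ(q)) ∑*_{χ mod q} |∑∑_{mn ≤ X(q,χ)} a_m b_n χ(mn)|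
  ≤ (2 + log P) ((M + 1 + 2Q²) ∑|a_m|²)^{1/2} ((N + 1 + 2Q²) ∑|b_n|²)^{1/2}`,
with `P = sepModulus (4(Y+1)) (M₀+M) (N₀+N)`, which is `≤ (4Y + 5)(M₀ + M)(N₀ + N)` when
`M₀ + M, N₀ + N ≥ 1` (`sepModulus_le`; for an empty box `P = 1`).
[cite: Vaughan1980, Lemma 2] -/
theorem largeSieve_bilinear_hyperbolic (Q Y : ℕ) (X : (q : ℕ) → DirichletCharacter ℂ q → ℕ)
    (hX : ∀ q χ, X q χ ≤ Y) :
    ∑ q ∈ Icc 1 Q, (q : ℝ) / q.totient *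
        ∑ χ : DirichletCharacter ℂ q with χ.IsPrimitive,
          ‖∑ m ∈ Ioc M₀ (M₀ + M), ∑ n ∈ Ioc N₀ (N₀ + N),
            (if m * n ≤ X q χ then a m * b n * χ (m * n) else 0)‖ ≤
      (2 + Real.log (sepModulus (4 * (Y + 1)) (M₀ + M) (N₀ + N))) *
        (Real.sqrt (((M : ℝ) + 1 + 2 * (Q : ℝ) ^ 2) * ∑ m ∈ Ioc M₀ (M₀ + M), ‖a m‖ ^ 2) *
          Real.sqrt (((N : ℝ) + 1 + 2 * (Q : ℝ) ^ 2) * ∑ n ∈ Ioc N₀ (N₀ + N), ‖b n‖ ^ 2)) := by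
  set T := 4 * (Y + 1) with hT
  set P := sepModulus T (M₀ + M) (N₀ + N) with hP
  set R : ℝ := Real.sqrt (((M : ℝ) + 1 + 2 * (Q : ℝ) ^ 2) * ∑ m ∈ Ioc M₀ (M₀ + M), ‖a m‖ ^ 2) *
    Real.sqrt (((N : ℝ) + 1 + 2 * (Q : ℝ) ^ 2) * ∑ n ∈ Ioc N₀ (N₀ + N), ‖b n‖ ^ 2) with hR
  -- the twisted bilinear forms obey Lemma 1 with the same right-hand side
  have hk : ∀ k : ℕ, ∑ q ∈ Icc 1 Q, (q : ℝ) / q.totient *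
      ∑ χ : DirichletCharacter ℂ q with χ.IsPrimitive,
        ‖∑ m ∈ Ioc M₀ (M₀ + M), ∑ n ∈ Ioc N₀ (N₀ + N),
          twist T P k a m * twist T P k b n * χ (m * n)‖ ≤ R := by
    intro k
    have h := largeSieve_bilinear (twist T P k a) (twist T P k b) M₀ M N₀ N Q
    simp only [norm_twist] at h
    exact h
  have hw : ∀ q : ℕ, 0 ≤ (q : ℝ) / q.totient := fun q => by positivity
  -- pointwise majorant, then swap the sums
  calc _ ≤ ∑ q ∈ Icc 1 Q, (q : ℝ) / q.totient *
        ∑ χ : DirichletCharacter ℂ q with χ.IsPrimitive, ∑ k ∈ range P, sepWeight P k *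
          ‖∑ m ∈ Ioc M₀ (M₀ + M), ∑ n ∈ Ioc N₀ (N₀ + N),
            twist T P k a m * twist T P k b n * χ (m * n)‖ := by
        refine sum_le_sum fun q _ => mul_le_mul_of_nonneg_left (sum_le_sum fun χ _ => ?_) (hw q)
        refine norm_sum_sum_ite_mul_le_le a b M₀ M N₀ N ?_ le_rfl χ
        have := hX q χ
        omega
    _ = ∑ k ∈ range P, sepWeight P k * ∑ q ∈ Icc 1 Q, (q : ℝ) / q.totient *
        ∑ χ : DirichletCharacter ℂ q with χ.IsPrimitive,
          ‖∑ m ∈ Ioc M₀ (M₀ + M), ∑ n ∈ Ioc N₀ (N₀ + N),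
            twist T P k a m * twist T P k b n * χ (m * n)‖ := by
        have e1 : ∀ q ∈ Icc 1 Q, (q : ℝ) / q.totient *
            ∑ χ : DirichletCharacter ℂ q with χ.IsPrimitive, ∑ k ∈ range P, sepWeight P k *
              ‖∑ m ∈ Ioc M₀ (M₀ + M), ∑ n ∈ Ioc N₀ (N₀ + N),
                twist T P k a m * twist T P k b n * χ (m * n)‖ =
            ∑ k ∈ range P, sepWeight P k * ((q : ℝ) / q.totient *
              ∑ χ : DirichletCharacter ℂ q with χ.IsPrimitive,
                ‖∑ m ∈ Ioc M₀ (M₀ + M), ∑ n ∈ Ioc N₀ (N₀ + N),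
                  twist T P k a m * twist T P k b n * χ (m * n)‖) := by
          intro q _
          rw [sum_comm, mul_sum]
          refine sum_congr rfl fun k _ => ?_
          rw [← mul_sum]; ring
        rw [sum_congr rfl e1, sum_comm]
        refine sum_congr rfl fun k _ => ?_
        rw [mul_sum]
    _ ≤ ∑ k ∈ range P, sepWeight P k * R :=
        sum_le_sum fun k _ => mul_le_mul_of_nonneg_left (hk k) (sepWeight_nonneg _ _)
    _ ≤ (2 + Real.log P) * R := by
        rw [← sum_mul]
        refine mul_le_mul_of_nonneg_right (sum_sepWeight_le (sepModulus_pos _ _ _)) ?_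
        positivity

end Hyperbolic

end Literature.NumberTheory.Sieve.LargeSieve
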